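import Mathlib
import HarnessLib
import Summits.NavierStokesRegularity.NavierStokesRegularity.Theorems.UnthreadedRigidityDoorUnthreadedRigiditySpectralEdgeBracketLaplacian
import Summits.NavierStokesRegularity.NavierStokesRegularity.Theorems.UnthreadedRigidityDoorUnthreadedRigidityThreadingJetsVirialFields
import Summits.NavierStokesRegularity.NavierStokesRegularity.Theorems.UnthreadedRigidityDoorUnthreadedRigidityVirialHornAngularLemma
import Literature.Analysis.FluidPDE.NewtonKernel
import Literature.Analysis.FluidPDE.NormalisedPressureFarFieldLimit

/-!
# Route `UnthreadedRigidityDoor`, wall item W2 `UnthreadedRigidity` (stmt-NavierStokesRegularity-27585) — LINES g13-1/g13-2 (ns-idea-6 g13,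
# `SpectralEdge_sketch.lean`, `EdgeCoercive_sketch.lean` v1.3; DIRECTOR-NS #303 (A)): ★ `HalfLaplacianInjective l` and ★★ E1_l =
# `EdgeAngularLemma l` FOR EVERY DEGREE `l`, VERBATIM (sketch-local `edgeForm` / `hessSq` / `gradSq` unfolded)

Seat ns-es-p1 g9.  THE SECOND-ORDER ANGULAR LEMMA E1_l, every `l`: a solid harmonic `Y` of degree `l` whose edge form
`48𝔅_l[Y] = Δ₃Φ − (4l²−20l+6)Φ − 2{Y, |∇²Y|² − 2(l−1)²|∇Y|²}` (`Φ = {Y,|∇Y|²}`) vanishes on the unit sphere is ZONAL.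

PROOF.  By the half-Laplacian form (`edgeHalfLaplacian`, from (I9) `bracketLaplacian`), `48𝔅_l = ½Δ₃Φ + (12l−2)Φ`.  SPECTRAL INJECTIVITY WITHOUT
SPHERICAL HARMONICS (`halfLaplacianInjective`): `Φ` is smooth and homogeneous of degree `d = 3l−3` (`ThreadingJets.angForm_smul'`), so
`½Δ₃Φ + cΦ = 0` on `S²` (`c = 12l−2`) rescales to the GLOBAL identity `|z|²Δ₃Φ + 2cΦ ≡ 0` (`Δ₃Φ` is homogeneous of degree `d−2`,
`lap3_homogeneous`, from `Literature.….fderiv_homogeneous`).  Now iterate: if a smooth `f`, homogeneous of integer degree `m`, satisfies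
`|z|²Δ₃f + cf ≡ 0` with `c > 0`, then `f ≡ 0` (`eq_zero_of_normSq_lap3_rel`, induction): for `m ≤ 1`, `Δ₃f` is homogeneous of NEGATIVE degree and
continuous at `0`, hence `0` (`eq_zero_of_homogeneous_neg`), so `cf ≡ 0`; for `m ≥ 2`, applying `Δ₃` and the commutator formula
`Δ₃(|z|²g) = (4k+6)g + |z|²Δ₃g` (`g` homogeneous of degree `k`, Euler; `lap3_normSq_mul`) to `g = Δ₃f` gives `|z|²Δ₃g + (c+4m−2)g ≡ 0` with
`c + 4m − 2 > 0` and `deg g = m−2`: induction.  Hence `Φ ≡ 0`, and the tree's angular lemma (`angularLemma_holds`) makes `Y` zonal.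

HONEST LABEL: E1_l is ONE typed input of K2 (third-order ghost rigidity) of the files-only RUNG line g12-4/g13 two levels below W2 — a statement about
solid harmonics, not about Navier–Stokes; the other inputs (O-EDGE: the closed form of `𝔅_l` is engine-derived, instrument R-EDGE-1; O-PEEL; E2) are NOT
touched here; nothing here bears on `UnthreadedRigidity` (27585), the door Target, W2 or Navier–Stokes regularity; no summit statement is proved.  0 kit.
[folklore; Euler 1755 (homogeneous functions)]
-/

noncomputable section

-- the summit and its single sub-problem share the name (CONVENTIONS §1), as in every Theorems file
set_option linter.dupNamespace false

namespace Summit.NavierStokesRegularity.NavierStokesRegularity.Theorems.UnthreadedRigidity.SpectralEdge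

open Set Function Filter Topology
open scoped RealInnerProductSpace ContDiff
open Literature.Analysis.FluidPDE (cross fderiv_homogeneous fderiv_apply_self_of_homogeneous)
open Summit.NavierStokesRegularity.NavierStokesRegularity.Theorems.UnthreadedRigidity.ProfileHorn (E3)
open Summit.NavierStokesRegularity.NavierStokesRegularity.Theorems.UnthreadedRigidity.VirialHorn

/-! ## §1 Generic second-order calculus: linearity, the product with `|z|²`, smoothness, homogeneity -/

section Generic

variable {f g : E3 → ℝ}

/-- `dir2` of a sum of `C²` functions. [folklore] -/
theorem dir2_add (hf : ContDiff ℝ 2 f) (hg : ContDiff ℝ 2 g) (v y : E3) :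
    dir2 (fun z => f z + g z) v y = dir2 f v y + dir2 g v y := by
  have hfd : Differentiable ℝ f := hf.differentiable (by norm_num)
  have hgd : Differentiable ℝ g := hg.differentiable (by norm_num)
  have hf1 : ∀ w : E3, Differentiable ℝ (fun z => fderiv ℝ f z w) := fun w =>
    ((hf.fderiv_right (m := 1) (by norm_num)).differentiable (by norm_num)).clm_apply (differentiable_const w)
  have hg1 : ∀ w : E3, Differentiable ℝ (fun z => fderiv ℝ g z w) := fun w =>
    ((hg.fderiv_right (m := 1) (by norm_num)).differentiable (by norm_num)).clm_apply (differentiable_const w)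
  unfold dir2
  have h1 : (fun z => fderiv ℝ (fun z => f z + g z) z v) = fun z => fderiv ℝ f z v + fderiv ℝ g z v := by
    funext z
    rw [fderiv_fun_add (hfd z) (hgd z)]
    rfl
  rw [h1, fderiv_fun_add (hf1 v y) (hg1 v y)]
  rfl

/-- `dir2` of a constant multiple of a `C²` function. [folklore] -/
theorem dir2_const_mul (hf : ContDiff ℝ 2 f) (c : ℝ) (v y : E3) :
    dir2 (fun z => c * f z) v y = c * dir2 f v y := by
  have hfd : Differentiable ℝ f := hf.differentiable (by norm_num)
  have hf1 : ∀ w : E3, Differentiable ℝ (fun z => fderiv ℝ f z w) := fun w =>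
    ((hf.fderiv_right (m := 1) (by norm_num)).differentiable (by norm_num)).clm_apply (differentiable_const w)
  unfold dir2
  have h1 : (fun z => fderiv ℝ (fun z => c * f z) z v) = fun z => c * fderiv ℝ f z v := by
    funext z
    rw [fderiv_const_mul (hfd z)]
    rfl
  rw [h1, fderiv_const_mul (hf1 v y)]
  rfl

/-- `Δ₃` of a sum of `C²` functions. [folklore] -/
theorem lap3_add (hf : ContDiff ℝ 2 f) (hg : ContDiff ℝ 2 g) (y : E3) :
    lap3 (fun z => f z + g z) y = lap3 f y + lap3 g y := by
  unfold lap3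
  simp only [dir2_add hf hg, Finset.sum_add_distrib]

/-- `Δ₃` of a constant multiple of a `C²` function. [folklore] -/
theorem lap3_const_mul (hf : ContDiff ℝ 2 f) (c : ℝ) (y : E3) : lap3 (fun z => c * f z) y = c * lap3 f y := by
  unfold lap3
  simp only [dir2_const_mul hf, Finset.mul_sum]

/-- THE PRODUCT RULE for `dir2`. [folklore] -/
theorem dir2_mul (hf : ContDiff ℝ 2 f) (hg : ContDiff ℝ 2 g) (v y : E3) :
    dir2 (fun z => g z * f z) v y = dir2 g v y * f y + 2 * (fderiv ℝ g y v * fderiv ℝ f y v) + g y * dir2 f v y := by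
  have hfd : Differentiable ℝ f := hf.differentiable (by norm_num)
  have hgd : Differentiable ℝ g := hg.differentiable (by norm_num)
  have hf1 : ∀ w : E3, Differentiable ℝ (fun z => fderiv ℝ f z w) := fun w =>
    ((hf.fderiv_right (m := 1) (by norm_num)).differentiable (by norm_num)).clm_apply (differentiable_const w)
  have hg1 : ∀ w : E3, Differentiable ℝ (fun z => fderiv ℝ g z w) := fun w =>
    ((hg.fderiv_right (m := 1) (by norm_num)).differentiable (by norm_num)).clm_apply (differentiable_const w)
  unfold dir2
  have h1 : (fun z => fderiv ℝ (fun z => g z * f z) z v) = fun z => fderiv ℝ g z v * f z + g z * fderiv ℝ f z v := by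
    funext z
    rw [fderiv_fun_mul (hgd z) (hfd z)]
    simp only [_root_.add_apply, FunLike.coe_smul, Pi.smul_apply, smul_eq_mul]
    ring
  rw [h1]
  have d1 : DifferentiableAt ℝ (fun z => fderiv ℝ g z v * f z) y := ((hg1 v) y).mul (hfd y)
  have d2 : DifferentiableAt ℝ (fun z => g z * fderiv ℝ f z v) y := (hgd y).mul ((hf1 v) y)
  rw [fderiv_fun_add d1 d2, _root_.add_apply, fderiv_fun_mul ((hg1 v) y) (hfd y), fderiv_fun_mul (hgd y) ((hf1 v) y)]
  simp only [_root_.add_apply, FunLike.coe_smul, Pi.smul_apply, smul_eq_mul]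
  ring

/-- `dir2` of `|z|²`: `D²_v|z|² = 2|v|²`, and `D_v|z|² = 2⟪z,v⟫`. [folklore] -/
theorem fderiv_normSq_apply (y v : E3) : fderiv ℝ (fun z : E3 => ‖z‖ ^ 2) y v = 2 * ⟪y, v⟫ := by
  rw [fderiv_norm_sq_apply]
  simp only [FunLike.coe_smul, Pi.smul_apply, innerSL_apply_apply, nsmul_eq_mul, Nat.cast_ofNat]

/-- `D²_v|z|² = 2|v|²`. [folklore] -/
theorem dir2_normSq (v y : E3) : dir2 (fun z : E3 => ‖z‖ ^ 2) v y = 2 * ‖v‖ ^ 2 := by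
  unfold dir2
  have h1 : (fun z : E3 => fderiv ℝ (fun z : E3 => ‖z‖ ^ 2) z v) = fun z : E3 => 2 * (innerSL ℝ v) z := by
    funext z
    rw [fderiv_normSq_apply z v, innerSL_apply_apply, real_inner_comm]
  rw [h1, fderiv_const_mul (innerSL ℝ v).differentiableAt, FunLike.coe_smul, Pi.smul_apply, smul_eq_mul, (innerSL ℝ v).fderiv,
    innerSL_apply_apply, real_inner_self_eq_norm_sq]

/-- a coordinate of a vector is its inner product with the basis vector (private copy). -/
private theorem apply_eq_inner_e'' (v : E3) (i : Fin 3) : v i = ⟪v, e i⟫ := by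
  rw [e, EuclideanSpace.inner_single_right]; simp

/-- ★ THE COMMUTATOR FORMULA: for `f` of class `C²`, homogeneous of integer degree `m`, `Δ₃(|z|² f) = (4m + 6) f + |z|² Δ₃f`
(`Δ|z|² = 6`, `2∇|z|²·∇f = 4 z·∇f = 4m f` by Euler). [folklore; Euler 1755] -/
theorem lap3_normSq_mul (hf : ContDiff ℝ 2 f) (m : ℤ) (hhom : ∀ c : ℝ, 0 < c → ∀ z : E3, f (c • z) = c ^ m • f z) (y : E3) :
    lap3 (fun z : E3 => ‖z‖ ^ 2 * f z) y = (4 * (m : ℝ) + 6) * f y + ‖y‖ ^ 2 * lap3 f y := by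
  have hn : ContDiff ℝ 2 (fun z : E3 => ‖z‖ ^ 2) := contDiff_norm_sq ℝ
  have hEuler : fderiv ℝ f y y = (m : ℝ) * f y := by
    have h := fderiv_apply_self_of_homogeneous f m hhom ((hf.differentiable (by norm_num)) y)
    rw [h, smul_eq_mul]
  unfold lap3
  simp only [dir2_mul hf hn, dir2_normSq, fderiv_normSq_apply, Finset.sum_add_distrib, ← Finset.mul_sum, ← Finset.sum_mul]
  have he : ∀ i : Fin 3, ‖e i‖ ^ 2 = 1 := fun i => by simp [e]
  simp only [he, Fin.sum_univ_three]
  -- `Σᵢ ⟪y,eᵢ⟫ D f(y) eᵢ = D f(y) y = m f(y)`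
  have hsum : 2 * ⟪y, e 0⟫ * fderiv ℝ f y (e 0) + 2 * ⟪y, e 1⟫ * fderiv ℝ f y (e 1) + 2 * ⟪y, e 2⟫ * fderiv ℝ f y (e 2)
      = 2 * fderiv ℝ f y y := by
    have hy : fderiv ℝ f y y = fderiv ℝ f y (∑ j : Fin 3, y j • e j) := by rw [← eq_sum_smul_e y]
    rw [hy, map_sum]
    simp only [Fin.sum_univ_three, map_smul, smul_eq_mul, apply_eq_inner_e'']
    ring
  rw [hsum, hEuler]
  ring

/-- `Δ₃` of a smooth function is smooth. [folklore] -/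
theorem contDiff_lap3 (hf : ContDiff ℝ ∞ f) : ContDiff ℝ ∞ (lap3 f) := by
  have h1 : ∀ w : E3, ContDiff ℝ ∞ (fun z => fderiv ℝ f z w) := fun w =>
    (hf.fderiv_right (m := ∞) le_rfl).clm_apply contDiff_const
  have h2 : ∀ v w : E3, ContDiff ℝ ∞ (fun z => fderiv ℝ (fun y => fderiv ℝ f y v) z w) := fun v w =>
    ((h1 v).fderiv_right (m := ∞) le_rfl).clm_apply contDiff_const
  unfold lap3 dir2
  exact ContDiff.sum fun i _ => h2 (e i) (e i)

/-- `Δ₃` lowers the degree of homogeneity by two (no differentiability needed). [folklore] -/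
theorem lap3_homogeneous (m : ℤ) (hhom : ∀ c : ℝ, 0 < c → ∀ z : E3, f (c • z) = c ^ m • f z) (c : ℝ) (hc : 0 < c) (z : E3) :
    lap3 f (c • z) = c ^ (m - 2) • lap3 f z := by
  have h1 : ∀ v : E3, ∀ a : ℝ, 0 < a → ∀ w : E3, (fun y => fderiv ℝ f y v) (a • w) = a ^ (m - 1) • (fun y => fderiv ℝ f y v) w := by
    intro v a ha w
    simp only [fderiv_homogeneous f m hhom a ha w, FunLike.coe_smul, Pi.smul_apply]
  unfold lap3 dir2
  rw [Finset.smul_sum]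
  refine Finset.sum_congr rfl fun i _ => ?_
  rw [fderiv_homogeneous (fun y => fderiv ℝ f y (e i)) (m - 1) (h1 (e i)) c hc z, FunLike.coe_smul, Pi.smul_apply]
  congr 1
  ring_nf

/-- a function continuous at `0` and homogeneous of NEGATIVE integer degree vanishes identically. [folklore] -/
theorem eq_zero_of_homogeneous_neg (hf : ContinuousAt f 0) (m : ℤ) (hm : m < 0)
    (hhom : ∀ c : ℝ, 0 < c → ∀ z : E3, f (c • z) = c ^ m • f z) (z : E3) : f z = 0 := by
  -- `f 0 = 0`
  have h0 : f 0 = 0 := by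
    have h := hhom 2 two_pos 0
    rw [smul_zero, smul_eq_mul] at h
    have h2 : (2 : ℝ) ^ m ≠ 1 := by
      have : (2 : ℝ) ^ m < 1 := zpow_lt_one_of_neg₀ (by norm_num) hm
      exact this.ne
    have : ((2 : ℝ) ^ m - 1) * f 0 = 0 := by linarith
    rcases mul_eq_zero.1 this with h3 | h3
    · exact absurd (sub_eq_zero.1 h3) h2
    · exact h3
  by_contra hz
  -- along `c • z`, `c → 0⁺`: `f (c • z) → f 0 = 0` but `|f (c • z)| = c^m |f z| ≥ |f z|` for `c ≤ 1`
  have hpos : 0 < |f z| := abs_pos.2 hz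
  have hcont : Tendsto (fun c : ℝ => f (c • z)) (𝓝[>] 0) (𝓝 0) := by
    have h1 : Tendsto (fun c : ℝ => c • z) (𝓝[>] 0) (𝓝 0) := by
      have : Tendsto (fun c : ℝ => c • z) (𝓝 0) (𝓝 ((0 : ℝ) • z)) := (continuous_id.smul continuous_const).tendsto 0
      rw [zero_smul] at this
      exact this.mono_left nhdsWithin_le_nhds
    have h2 := hf.tendsto.comp h1
    rwa [h0] at h2
  have hev : ∀ᶠ c : ℝ in 𝓝[>] 0, |f (c • z)| < |f z| := by
    have := (hcont.abs).eventually (gt_mem_nhds (a := |f z|) (by rw [abs_zero]; exact hpos))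
    exact this
  have hev2 : ∀ᶠ c : ℝ in 𝓝[>] 0, c ≤ 1 := by
    have : Set.Ioo (0 : ℝ) 1 ∈ 𝓝[>] (0 : ℝ) := Ioo_mem_nhdsGT one_pos
    filter_upwards [this] with c hc using hc.2.le
  obtain ⟨c, ⟨hlt, hle⟩, hcpos⟩ := ((hev.and hev2).and self_mem_nhdsWithin).exists
  have hc : 0 < c := hcpos
  rw [hhom c hc z, smul_eq_mul, abs_mul, abs_of_pos (zpow_pos hc m)] at hlt
  have hge : 1 ≤ c ^ m := one_le_zpow_of_nonpos₀ hc hle hm.le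
  nlinarith

/-- the value at `0` of a function satisfying the relation is irrelevant: `‖0‖² = 0`; a homogeneous function of nonzero degree vanishes at `0`. -/
theorem eq_zero_at_zero_of_homogeneous (m : ℤ) (hm : m ≠ 0) (hhom : ∀ c : ℝ, 0 < c → ∀ z : E3, f (c • z) = c ^ m • f z) :
    f 0 = 0 := by
  have h := hhom 2 two_pos 0
  rw [smul_zero, smul_eq_mul] at h
  have h2 : (2 : ℝ) ^ m ≠ 1 := by
    rcases lt_or_gt_of_ne hm with hm' | hm'
    · exact (zpow_lt_one_of_neg₀ (by norm_num) hm').ne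
    · exact (one_lt_zpow₀ (by norm_num) hm').ne'
  have : ((2 : ℝ) ^ m - 1) * f 0 = 0 := by linarith
  rcases mul_eq_zero.1 this with h3 | h3
  · exact absurd (sub_eq_zero.1 h3) h2
  · exact h3

/-- ★ THE ITERATION: a smooth `f`, homogeneous of integer degree `m ≤ 2n − 3`, with `|z|²Δ₃f + c f ≡ 0` for some `c > 0`, vanishes identically
(induction on `n`; module docstring). [folklore] -/
theorem eq_zero_of_normSq_lap3_rel : ∀ (n : ℕ) (f : E3 → ℝ) (m : ℤ), m ≤ 2 * (n : ℤ) - 3 → ContDiff ℝ ∞ f →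
    (∀ c : ℝ, 0 < c → ∀ z : E3, f (c • z) = c ^ m • f z) →
    (∃ c : ℝ, 0 < c ∧ ∀ z : E3, ‖z‖ ^ 2 * lap3 f z + c * f z = 0) → ∀ z : E3, f z = 0 := by
  intro n
  induction n with
  | zero =>
    intro f m hm hf hhom _ z
    exact eq_zero_of_homogeneous_neg hf.continuous.continuousAt m (by omega) hhom z
  | succ n ih =>
    intro f m hm hf hhom hrel z
    obtain ⟨c, hc, hcz⟩ := hrel
    -- `g = Δ₃ f`: smooth, homogeneous of degree `m − 2`
    have hg : ContDiff ℝ ∞ (lap3 f) := contDiff_lap3 hf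
    have hghom : ∀ a : ℝ, 0 < a → ∀ w : E3, lap3 f (a • w) = a ^ (m - 2) • lap3 f w :=
      fun a ha w => lap3_homogeneous m hhom a ha w
    -- it suffices that `Δ₃ f ≡ 0`
    suffices hg0 : ∀ w : E3, lap3 f w = 0 by
      have h := hcz z
      rw [hg0 z, mul_zero, zero_add] at h
      rcases mul_eq_zero.1 h with h' | h'
      · exact absurd h' hc.ne'
      · exact h'
    rcases le_or_gt m 1 with hm1 | hm1
    · -- `deg Δ₃f = m − 2 < 0`
      exact fun w => eq_zero_of_homogeneous_neg hg.continuous.continuousAt (m - 2) (by omega) hghom w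
    · -- `m ≥ 2`: the relation for `Δ₃ f` with the constant `c + 4m − 2 > 0`, and the induction hypothesis
      refine ih (lap3 f) (m - 2) (by omega) hg hghom ⟨c + 4 * (m : ℝ) - 2, ?_, fun w => ?_⟩
      · have : (2 : ℝ) ≤ (m : ℝ) := by exact_mod_cast hm1
        linarith
      · -- apply `Δ₃` to the identically vanishing `|z|²Δ₃f + c f`
        have hF : (fun z : E3 => ‖z‖ ^ 2 * lap3 f z + c * f z) = fun _ => (0 : ℝ) := funext hcz
        have hL : lap3 (fun z : E3 => ‖z‖ ^ 2 * lap3 f z + c * f z) w = 0 := by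
          rw [hF]
          unfold lap3 dir2
          simp
        have hg2 : ContDiff ℝ 2 (lap3 f) := hg.of_le (by norm_cast)
        have hf2 : ContDiff ℝ 2 f := hf.of_le (by norm_cast)
        have hn2 : ContDiff ℝ 2 (fun z : E3 => ‖z‖ ^ 2 * lap3 f z) := (contDiff_norm_sq ℝ).mul hg2
        rw [lap3_add hn2 (contDiff_const.mul hf2), lap3_const_mul hf2, lap3_normSq_mul hg2 (m - 2) hghom] at hL
        push_cast at hL
        linear_combination hL

end Generic

/-! ## §2 ★ `HalfLaplacianInjective l`, VERBATIM, every degree -/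

/-- ★ **the sketch's `HalfLaplacianInjective l` VERBATIM**, every degree, WITHOUT spherical harmonics: if `½Δ₃{Y,|∇Y|²} + (12l−2){Y,|∇Y|²} = 0`
on the unit sphere then `{Y,|∇Y|²} = 0` on the unit sphere (indeed everywhere; module docstring). -/
theorem halfLaplacianInjective (l : ℕ) :
    ∀ Y : E3 → ℝ, IsSolidHarmonic l Y →
      (∀ y : E3, ‖y‖ = 1 → (1 / 2) * lap3 (angForm Y) y + (12 * (l : ℝ) - 2) * angForm Y y = 0) →
      ∀ y : E3, ‖y‖ = 1 → angForm Y y = 0 := by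
  intro Y hY hS y _
  -- `Φ = angForm Y` is smooth and homogeneous of degree `3l − 3`
  have hΦ : ContDiff ℝ ∞ (angForm Y) := ThreadingJets.contDiff_angForm hY
  have hhom : ∀ c : ℝ, 0 < c → ∀ z : E3, angForm Y (c • z) = c ^ ((3 * l : ℤ) - 3) • angForm Y z :=
    ThreadingJets.angForm_smul' hY
  rcases Nat.eq_zero_or_pos l with hl | hl
  · -- degree `−3 < 0`: `Φ ≡ 0` outright
    subst hl
    exact eq_zero_of_homogeneous_neg hΦ.continuous.continuousAt _ (by norm_num) hhom y
  -- the global relation `|z|² Δ₃Φ + 2(12l−2) Φ ≡ 0`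
  have hrel : ∀ z : E3, ‖z‖ ^ 2 * lap3 (angForm Y) z + (2 * (12 * (l : ℝ) - 2)) * angForm Y z = 0 := by
    intro z
    rcases eq_or_ne z 0 with hz | hz
    · subst hz
      have h0 : angForm Y 0 = 0 := by simp [angForm, pbr, det3]
      rw [h0, norm_zero]; ring
    · have hr : 0 < ‖z‖ := norm_pos_iff.2 hz
      set u : E3 := ‖z‖⁻¹ • z with hu
      have hun : ‖u‖ = 1 := by rw [hu, norm_smul, norm_inv, norm_norm, inv_mul_cancel₀ hr.ne']
      have hzu : z = ‖z‖ • u := by rw [hu, smul_smul, mul_inv_cancel₀ hr.ne', one_smul]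
      have h1 : angForm Y z = ‖z‖ ^ ((3 * l : ℤ) - 3) * angForm Y u := by
        conv_lhs => rw [hzu]
        rw [hhom _ hr u, smul_eq_mul]
      have h2 : lap3 (angForm Y) z = ‖z‖ ^ ((3 * l : ℤ) - 3 - 2) * lap3 (angForm Y) u := by
        conv_lhs => rw [hzu]
        rw [lap3_homogeneous ((3 * l : ℤ) - 3) hhom _ hr u, smul_eq_mul]
      have h3 := hS u hun
      have hpow : ‖z‖ ^ 2 * ‖z‖ ^ ((3 * l : ℤ) - 3 - 2) = ‖z‖ ^ ((3 * l : ℤ) - 3) := by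
        rw [← zpow_natCast, ← zpow_add₀ hr.ne']
        congr 1
        push_cast
        ring
      rw [h1, h2, ← mul_assoc, hpow]
      have : ‖z‖ ^ ((3 * l : ℤ) - 3) * lap3 (angForm Y) u + 2 * (12 * (l : ℝ) - 2) * (‖z‖ ^ ((3 * l : ℤ) - 3) * angForm Y u)
          = ‖z‖ ^ ((3 * l : ℤ) - 3) * (2 * ((1 / 2) * lap3 (angForm Y) u + (12 * (l : ℝ) - 2) * angForm Y u)) := by ring
      rw [this, h3, mul_zero, mul_zero]
  -- iterate: degree `3l − 3 ≤ 2(2l) − 3`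
  have hc : 0 < 2 * (12 * (l : ℝ) - 2) := by
    have : (1 : ℝ) ≤ (l : ℝ) := by exact_mod_cast hl
    linarith
  exact eq_zero_of_normSq_lap3_rel (2 * l) (angForm Y) ((3 * l : ℤ) - 3) (by push_cast; omega) hΦ hhom ⟨_, hc, hrel⟩ y

/-! ## §3 ★★ E1_l = `EdgeAngularLemma l`, VERBATIM, every degree -/

/-- ★★ **E1_l — the sketch's `EdgeAngularLemma l` VERBATIM** (sketch-local `edgeForm` / `hessSq` / `gradSq` unfolded), EVERY DEGREE `l`: a solid
harmonic of degree `l` whose edge form vanishes on the unit sphere is zonal (the sketch's `edgeAngularLemma_of_halfLaplacian` with both hypotheses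
`EdgeHalfLaplacian l` (`edgeHalfLaplacian`) and `HalfLaplacianInjective l` (`halfLaplacianInjective`) discharged, then the cone property of
`{Y,|∇Y|²}` and the tree's angular lemma `angularLemma_holds`). -/
theorem edgeAngularLemma (l : ℕ) :
    ∀ Y : E3 → ℝ, IsSolidHarmonic l Y →
      (∀ y : E3, ‖y‖ = 1 →
        lap3 (angForm Y) y - (4 * (l : ℝ) ^ 2 - 20 * (l : ℝ) + 6) * angForm Y y
          - 2 * pbr Y (fun z => (∑ i : Fin 3, ‖fderiv ℝ (gradient Y) z (e i)‖ ^ 2)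
              - 2 * ((l : ℝ) - 1) ^ 2 * ‖gradient Y z‖ ^ 2) y = 0) →
      IsZonal Y := by
  intro Y hY hE
  -- `½Δ₃Φ + (12l−2)Φ = 0` on the unit sphere
  have hS : ∀ y : E3, ‖y‖ = 1 → (1 / 2) * lap3 (angForm Y) y + (12 * (l : ℝ) - 2) * angForm Y y = 0 := by
    intro y hy
    rw [← edgeHalfLaplacian l Y hY y]
    exact hE y hy
  have hS0 := halfLaplacianInjective l Y hY hS
  -- hence everywhere (cone property)
  have hA : ∀ y : E3, angForm Y y = 0 := by
    intro y
    rcases eq_or_ne y 0 with hy | hy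
    · subst hy
      simp [angForm, pbr, det3]
    · have hn : 0 < ‖y‖ := norm_pos_iff.2 hy
      set u : E3 := ‖y‖⁻¹ • y with hu
      have hun : ‖u‖ = 1 := by rw [hu, norm_smul, norm_inv, norm_norm, inv_mul_cancel₀ hn.ne']
      have hyu : y = ‖y‖ • u := by rw [hu, smul_smul, mul_inv_cancel₀ hn.ne', one_smul]
      rw [hyu, ThreadingJets.angForm_smul hY hn u, hS0 u hun, mul_zero]
  exact angularLemma_holds l Y hY hA

end Summit.NavierStokesRegularity.NavierStokesRegularity.Theorems.UnthreadedRigidity.SpectralEdge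

end
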